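import Mathlib
import HarnessLib
import Summits.ResolutionOfSingularities.ResolutionOfSingularities.Theorems.WildQuotientsWildQuotientResolutionS1aSectionGlueKillAssoc

/-!
# S1a — R4c cusp assembly: the THREE-CHART, FIRST-ORDER form of the glue-and-kill lemma (`killsIn_one_of_threeCharts_global`)

[OURS · L1 W4.5c · crux stmt-ResolutionOfSingularities-17941 `CyclicQuotientFourfolds`, line `s1a-logminvertex` v13 (`stub_reachLowerInFX`); R4c cusp, the
glue-and-kill step (b6)/(b7) of `Lines/s1a_logminvertex-R4c-PROGRESS-v2.md`] — NOT statements of the manuscript; counted 0; AI-level work, weaker than expert review.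

WHY THIS FILE. The skeleton `cusp_killsIn_two` (crux dir `Lines/s1a_logminvertex_CuspKillsIn_skeleton.lean`, v3 of leafhand-res-wildquotients-7 g1) has all
three member charts `U_O ⊂ O′₀₁`, `U_{Q,1} ⊂ O′₁₁`, `U_{Q,2} ⊂ O′₁₂` REAL, each exported by ✓`exists_cuspO_memberChart_rel_xi_units` /
✓`exists_cuspQ_memberChart_rel_units` / ✓`exists_cuspQv_memberChart_rel_units` in the shape
`a′·(rξ|U)³ = r0|U`, `bb·(rξ|U)² = rt|U`, units on `D(z₀) ∩ U`, `D(z₁) ∩ U`, and `∃ d₀ > 0, ∀ l > 0, ∃ 𝒦₀, principal-centre chart of degree d₀·l + hsec`.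
Its last step — the APPLICATION of ✓`killsIn_one_of_sectionCharts_of_associated` with `η = Fin 3` families assembled by `choose` / `Fin.cases`, a
`Sum`-indexed cover and `?_` obligations — timed out at `whnf` (16M heartbeats, two seats). This file removes every family from the call site: the lemma
below takes the three charts' data as SEPARATE first-order arguments, literally in the member lemmas' export shape, chooses the common Veronese degree
itself, discharges the gluing hypothesis `hass` by the global normaliser (✓`associated_sections_of_mul_pow_eq_global`, `ζ ≠ 0` on the integral model), and
derives the unit clauses over `D(γ₀)` (`= π⁻¹D(x₀)`) and `D(γ₁)` from the relations; what is left to the caller is first-order: two open families `Z₀, Z₁`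
(the `O′ᵢⱼ ∩ D(z₀)`, `O′ᵢⱼ ∩ D(z₁)` pieces), the pointwise cover, the six unit clauses on them, and the formal-locus containment.
* `AlgebraicGeometry.Scheme.mem_basicOpen_of_mul_eq_map` — `a·t = (γ|W)|U` and `v ∈ U ∩ D(γ)` ⇒ `v ∈ D(a)`;
* ★★ `GameFrame.GModel.killsIn_one_of_threeCharts_global`.
-/

set_option linter.dupNamespace false

noncomputable section

open CategoryTheory Limits AlgebraicGeometry TopologicalSpace Topology Opposite
open Literature.AlgebraicGeometry.Resolution Literature.AlgebraicGeometry.RelativeSpec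
open Summit.ResolutionOfSingularities.ResolutionOfSingularities.Theorems.WildQuotientResolution.S1
open Summit.ResolutionOfSingularities.ResolutionOfSingularities.Theorems.WildQuotientResolution.S1.NodeAtlas
open Summit.ResolutionOfSingularities.ResolutionOfSingularities.Theorems.WildQuotientResolution.S1.NpFrame
open Summit.ResolutionOfSingularities.ResolutionOfSingularities.Theorems.WildQuotientResolution.S1.KillGlue

namespace AlgebraicGeometry.Scheme

/-- **A section dividing the restriction of a global section is invertible where that global section is** (deliberate dot-notation extension of
Mathlib's `AlgebraicGeometry.Scheme` namespace, as ✓`Scheme.map_eq_map_of_mul_pow_eq`): if `a · t = (r)|U` with `r = γ|W` for a global section `γ`,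
then every `v ∈ U ∩ D(γ)` lies in `D(a)`. [folklore] -/
theorem mem_basicOpen_of_mul_eq_map {V : Scheme} {W U : V.Opens} (hUW : U ≤ W) {a t : Γ(V, U)} {r : Γ(V, W)} {γ : Γ(V, ⊤)}
    (hr : r = (V.presheaf.map (homOfLE (le_top : W ≤ ⊤)).op).hom γ) (h : a * t = (V.presheaf.map (homOfLE hUW).op).hom r)
    {v : V} (hvU : v ∈ U) (hv : v ∈ V.basicOpen γ) : v ∈ V.basicOpen a := by
  have h1 : v ∈ V.basicOpen ((V.presheaf.map (homOfLE hUW).op).hom r) := by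
    rw [hr, ← CommRingCat.comp_apply, ← Functor.map_comp]
    erw [Scheme.basicOpen_res]
    exact ⟨hvU, hv⟩
  rw [← h, Scheme.basicOpen_mul] at h1
  exact h1.1

end AlgebraicGeometry.Scheme

namespace Summit.ResolutionOfSingularities.ResolutionOfSingularities.Theorems.WildQuotientResolution.S1.GameFrame.GModel

variable {p : ℕ} {X' X₁ : Scheme.{0}} {q : X' ⟶ X₁} {G : Type} [Group G] {ρ : G →* Aut X'} {g₀ : G}

set_option maxHeartbeats 4000000 in
/-- ★★ **THREE SECTION-PRESENTED MEMBER CHARTS WITH A COMMON GLOBAL NORMALISER KILL IN ONE MOVE — first-order form.** On an integral realisation `M`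
with atlas `𝔄`, let `ζ, γ₀, γ₁` be global sections with `ζ ≠ 0` (R4c: `π^*ξ_O`, `π^*x₀`, `π^*f`). For each of three `G`-stable affine charts `Oᵢ ≤ Wᵢ`
(`W` the producer chart carrying the restrictions `rζᵢ, r₀ᵢ, r₁ᵢ` of `ζ, γ₀, γ₁`) let sections `aᵢ, bᵢ ∈ Γ(Oᵢ)` satisfy `aᵢ·(rζᵢ|Oᵢ)^e₀ = r₀ᵢ|Oᵢ`,
`bᵢ·(rζᵢ|Oᵢ)^e₁ = r₁ᵢ|Oᵢ`, and let `Oᵢ` be a principal-centre chart in every degree `dᵢ·l` for a filtration that is, affine-locally, the weighted filtration of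
`(aᵢ : w 0, bᵢ : w 1)` — verbatim the export of ✓`exists_cuspO_memberChart_rel_xi_units` and its two `Q`-side companions. If two open families `Z₀ t`, `Z₁ t`
cover `M` together with the three charts and `D(γ₀)`, `D(γ₁)`, with `aᵢ` invertible on `Oᵢ ∩ Z₀ t` and `bᵢ` on `Oᵢ ∩ Z₁ t`, and the carried formal locus lies
in `O₀ ∪ O₁ ∪ O₂`, then `KillsIn 1 M`. Proof: common degree `d₀d₁d₂`; neighbouring generators are equal on overlaps by cancellation of `ζ`
(✓`associated_sections_of_mul_pow_eq_global`); `aᵢ` is invertible on `Oᵢ ∩ D(γ₀)` and `bᵢ` on `Oᵢ ∩ D(γ₁)` by the relations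
(`Scheme.mem_basicOpen_of_mul_eq_map`); conclude by ✓`killsIn_one_of_sectionCharts_of_associated` with `η = Fin 3`, cover index `(ι₀ ⊕ ι₁) ⊕ Fin 2`.
[OURS · L1 W4.5c · R4c (b6)/(b7); NOT a statement of the manuscript] -/
theorem killsIn_one_of_threeCharts_global [Finite G] (hp : p.Prime) (hG : ∀ g : G, g ∈ Subgroup.zpowers g₀)
    {k : Type} [Field k] (f : X₁ ⟶ Spec (.of k)) [LocallyOfFiniteType f] [IsFinite q]
    (M : GModel p q G ρ g₀) [M.V.IsSeparated] [IsIntegral M.V] (𝔄 : NodeAtlasData p M.act g₀)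
    -- the global normaliser, the two global numerators, exponents and weights
    (ζ γ₀ γ₁ : Γ(M.V, ⊤)) (hζ : ζ ≠ 0) (e₀ e₁ : ℕ) (w : Fin 2 → ℕ) (hw : ∀ l, 0 < w l)
    -- ### chart 0
    (W₀ : M.V.Opens) (O₀ : M.act.StableAffineOpens) (h₀ : O₀.1 ≤ W₀) (rζ₀ r₀₀ r₁₀ : Γ(M.V, W₀))
    (hrζ₀ : rζ₀ = (M.V.presheaf.map (homOfLE (le_top : W₀ ≤ ⊤)).op).hom ζ)
    (hr₀₀ : r₀₀ = (M.V.presheaf.map (homOfLE (le_top : W₀ ≤ ⊤)).op).hom γ₀)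
    (hr₁₀ : r₁₀ = (M.V.presheaf.map (homOfLE (le_top : W₀ ≤ ⊤)).op).hom γ₁)
    (a₀ b₀ : Γ(M.V, O₀.1))
    (hRa₀ : a₀ * (M.V.presheaf.map (homOfLE h₀).op).hom rζ₀ ^ e₀ = (M.V.presheaf.map (homOfLE h₀).op).hom r₀₀)
    (hRb₀ : b₀ * (M.V.presheaf.map (homOfLE h₀).op).hom rζ₀ ^ e₁ = (M.V.presheaf.map (homOfLE h₀).op).hom r₁₀)
    (hK₀ : ∃ d₀ : ℕ, 0 < d₀ ∧ ∀ l : ℕ, 0 < l → ∃ 𝒦₀ : ReesFiltration M.V, IsPrincipalCentreChart p M.act g₀ 𝒦₀ (d₀ * l) O₀ ∧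
      ∀ (U' : M.V.affineOpens) (hU : U'.1 ≤ O₀.1) (n : ℕ), (𝒦₀.filtration U').ideal n =
        (weightedFiltration (fun l' => (M.V.presheaf.map (homOfLE hU).op).hom ((![a₀, b₀] : Fin 2 → Γ(M.V, O₀.1)) l')) w).ideal n)
    -- ### chart 1
    (W₁ : M.V.Opens) (O₁ : M.act.StableAffineOpens) (h₁ : O₁.1 ≤ W₁) (rζ₁ r₀₁ r₁₁ : Γ(M.V, W₁))
    (hrζ₁ : rζ₁ = (M.V.presheaf.map (homOfLE (le_top : W₁ ≤ ⊤)).op).hom ζ)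
    (hr₀₁ : r₀₁ = (M.V.presheaf.map (homOfLE (le_top : W₁ ≤ ⊤)).op).hom γ₀)
    (hr₁₁ : r₁₁ = (M.V.presheaf.map (homOfLE (le_top : W₁ ≤ ⊤)).op).hom γ₁)
    (a₁ b₁ : Γ(M.V, O₁.1))
    (hRa₁ : a₁ * (M.V.presheaf.map (homOfLE h₁).op).hom rζ₁ ^ e₀ = (M.V.presheaf.map (homOfLE h₁).op).hom r₀₁)
    (hRb₁ : b₁ * (M.V.presheaf.map (homOfLE h₁).op).hom rζ₁ ^ e₁ = (M.V.presheaf.map (homOfLE h₁).op).hom r₁₁)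
    (hK₁ : ∃ d₁ : ℕ, 0 < d₁ ∧ ∀ l : ℕ, 0 < l → ∃ 𝒦₀ : ReesFiltration M.V, IsPrincipalCentreChart p M.act g₀ 𝒦₀ (d₁ * l) O₁ ∧
      ∀ (U' : M.V.affineOpens) (hU : U'.1 ≤ O₁.1) (n : ℕ), (𝒦₀.filtration U').ideal n =
        (weightedFiltration (fun l' => (M.V.presheaf.map (homOfLE hU).op).hom ((![a₁, b₁] : Fin 2 → Γ(M.V, O₁.1)) l')) w).ideal n)
    -- ### chart 2
    (W₂ : M.V.Opens) (O₂ : M.act.StableAffineOpens) (h₂ : O₂.1 ≤ W₂) (rζ₂ r₀₂ r₁₂ : Γ(M.V, W₂))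
    (hrζ₂ : rζ₂ = (M.V.presheaf.map (homOfLE (le_top : W₂ ≤ ⊤)).op).hom ζ)
    (hr₀₂ : r₀₂ = (M.V.presheaf.map (homOfLE (le_top : W₂ ≤ ⊤)).op).hom γ₀)
    (hr₁₂ : r₁₂ = (M.V.presheaf.map (homOfLE (le_top : W₂ ≤ ⊤)).op).hom γ₁)
    (a₂ b₂ : Γ(M.V, O₂.1))
    (hRa₂ : a₂ * (M.V.presheaf.map (homOfLE h₂).op).hom rζ₂ ^ e₀ = (M.V.presheaf.map (homOfLE h₂).op).hom r₀₂)
    (hRb₂ : b₂ * (M.V.presheaf.map (homOfLE h₂).op).hom rζ₂ ^ e₁ = (M.V.presheaf.map (homOfLE h₂).op).hom r₁₂)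
    (hK₂ : ∃ d₂ : ℕ, 0 < d₂ ∧ ∀ l : ℕ, 0 < l → ∃ 𝒦₀ : ReesFiltration M.V, IsPrincipalCentreChart p M.act g₀ 𝒦₀ (d₂ * l) O₂ ∧
      ∀ (U' : M.V.affineOpens) (hU : U'.1 ≤ O₂.1) (n : ℕ), (𝒦₀.filtration U').ideal n =
        (weightedFiltration (fun l' => (M.V.presheaf.map (homOfLE hU).op).hom ((![a₂, b₂] : Fin 2 → Γ(M.V, O₂.1)) l')) w).ideal n)
    -- ### the cover: the three charts, `D(γ₀)`, `D(γ₁)`, and two open families on which `a` resp. `b` is invertible chart by chart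
    {ι₀ ι₁ : Type} (Z₀ : ι₀ → M.V.Opens) (Z₁ : ι₁ → M.V.Opens)
    (hcov : ∀ x : M.V, x ∈ O₀.1 ∨ x ∈ O₁.1 ∨ x ∈ O₂.1 ∨ x ∈ M.V.basicOpen γ₀ ∨ x ∈ M.V.basicOpen γ₁ ∨ (∃ t, x ∈ Z₀ t) ∨ ∃ t, x ∈ Z₁ t)
    (hua₀ : ∀ t, ∀ v ∈ O₀.1, v ∈ Z₀ t → v ∈ M.V.basicOpen a₀) (hub₀ : ∀ t, ∀ v ∈ O₀.1, v ∈ Z₁ t → v ∈ M.V.basicOpen b₀)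
    (hua₁ : ∀ t, ∀ v ∈ O₁.1, v ∈ Z₀ t → v ∈ M.V.basicOpen a₁) (hub₁ : ∀ t, ∀ v ∈ O₁.1, v ∈ Z₁ t → v ∈ M.V.basicOpen b₁)
    (hua₂ : ∀ t, ∀ v ∈ O₂.1, v ∈ Z₀ t → v ∈ M.V.basicOpen a₂) (hub₂ : ∀ t, ∀ v ∈ O₂.1, v ∈ Z₁ t → v ∈ M.V.basicOpen b₂)
    -- ### the carried formal locus
    (hF : 𝔄.fLocus ⊆ ((O₀.1 : Set M.V) ∪ O₁.1) ∪ O₂.1) :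
    KillsIn 1 M := by
  classical
  -- ### the common Veronese degree `d₀·d₁·d₂`
  obtain ⟨d₀, hd₀, hK₀⟩ := hK₀
  obtain ⟨d₁, hd₁, hK₁⟩ := hK₁
  obtain ⟨d₂, hd₂, hK₂⟩ := hK₂
  obtain ⟨K₀, hprin₀, hsec₀⟩ := hK₀ (d₁ * d₂) (Nat.mul_pos hd₁ hd₂)
  obtain ⟨K₁, hprin₁, hsec₁⟩ := hK₁ (d₀ * d₂) (Nat.mul_pos hd₀ hd₂)
  obtain ⟨K₂, hprin₂, hsec₂⟩ := hK₂ (d₀ * d₁) (Nat.mul_pos hd₀ hd₁)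
  have hD : 0 < d₀ * (d₁ * d₂) := Nat.mul_pos hd₀ (Nat.mul_pos hd₁ hd₂)
  rw [show d₁ * (d₀ * d₂) = d₀ * (d₁ * d₂) by ring] at hprin₁
  rw [show d₂ * (d₀ * d₁) = d₀ * (d₁ * d₂) by ring] at hprin₂
  -- ### the `Fin 3` families (built here, once, from variables — never at a call site)
  let O : Fin 3 → M.act.StableAffineOpens := ![O₀, O₁, O₂]
  let 𝒦 : Fin 3 → ReesFiltration M.V := ![K₀, K₁, K₂]
  let W : Fin 3 → M.V.Opens := ![W₀, W₁, W₂]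
  let a : ∀ i : Fin 3, Fin 2 → Γ(M.V, (O i).1) := fun i =>
    Fin.cases (motive := fun i => Fin 2 → Γ(M.V, (O i).1)) ![a₀, b₀]
      (fun j => Fin.cases (motive := fun j : Fin 2 => Fin 2 → Γ(M.V, (O j.succ).1)) ![a₁, b₁]
        (fun j' => Fin.cases (motive := fun j' : Fin 1 => Fin 2 → Γ(M.V, (O j'.succ.succ).1)) ![a₂, b₂] (fun j'' => j''.elim0) j') j) i
  have hOW : ∀ i, (O i).1 ≤ W i := fun i => by
    fin_cases i
    · exact h₀
    · exact h₁
    · exact h₂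
  have hprin : ∀ i, IsPrincipalCentreChart p M.act g₀ (𝒦 i) (d₀ * (d₁ * d₂)) (O i) := fun i => by
    fin_cases i
    · exact hprin₀
    · exact hprin₁
    · exact hprin₂
  have hsec : ∀ i (U : M.V.affineOpens) (hU : U.1 ≤ (O i).1) (n : ℕ),
      ((𝒦 i).filtration U).ideal n = (weightedFiltration (fun l => (M.V.presheaf.map (homOfLE hU).op).hom (a i l)) w).ideal n := fun i => by
    fin_cases i
    · exact hsec₀
    · exact hsec₁
    · exact hsec₂
  -- ### gluing: neighbouring generators are equal on overlaps (cancel the global `ζ ≠ 0`)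
  have hR : ∀ i l, a i l * (M.V.presheaf.map (homOfLE (hOW i)).op).hom ((M.V.presheaf.map (homOfLE (le_top : W i ≤ ⊤)).op).hom ζ) ^ (![e₀, e₁] : Fin 2 → ℕ) l =
      (M.V.presheaf.map (homOfLE (hOW i)).op).hom ((M.V.presheaf.map (homOfLE (le_top : W i ≤ ⊤)).op).hom ((![γ₀, γ₁] : Fin 2 → Γ(M.V, ⊤)) l)) := by
    intro i l
    fin_cases i <;> fin_cases l
    · show a₀ * (M.V.presheaf.map (homOfLE h₀).op).hom ((M.V.presheaf.map (homOfLE (le_top : W₀ ≤ ⊤)).op).hom ζ) ^ e₀ =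
        (M.V.presheaf.map (homOfLE h₀).op).hom ((M.V.presheaf.map (homOfLE (le_top : W₀ ≤ ⊤)).op).hom γ₀)
      rw [← hrζ₀, ← hr₀₀]; exact hRa₀
    · show b₀ * (M.V.presheaf.map (homOfLE h₀).op).hom ((M.V.presheaf.map (homOfLE (le_top : W₀ ≤ ⊤)).op).hom ζ) ^ e₁ =
        (M.V.presheaf.map (homOfLE h₀).op).hom ((M.V.presheaf.map (homOfLE (le_top : W₀ ≤ ⊤)).op).hom γ₁)
      rw [← hrζ₀, ← hr₁₀]; exact hRb₀
    · show a₁ * (M.V.presheaf.map (homOfLE h₁).op).hom ((M.V.presheaf.map (homOfLE (le_top : W₁ ≤ ⊤)).op).hom ζ) ^ e₀ =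
        (M.V.presheaf.map (homOfLE h₁).op).hom ((M.V.presheaf.map (homOfLE (le_top : W₁ ≤ ⊤)).op).hom γ₀)
      rw [← hrζ₁, ← hr₀₁]; exact hRa₁
    · show b₁ * (M.V.presheaf.map (homOfLE h₁).op).hom ((M.V.presheaf.map (homOfLE (le_top : W₁ ≤ ⊤)).op).hom ζ) ^ e₁ =
        (M.V.presheaf.map (homOfLE h₁).op).hom ((M.V.presheaf.map (homOfLE (le_top : W₁ ≤ ⊤)).op).hom γ₁)
      rw [← hrζ₁, ← hr₁₁]; exact hRb₁
    · show a₂ * (M.V.presheaf.map (homOfLE h₂).op).hom ((M.V.presheaf.map (homOfLE (le_top : W₂ ≤ ⊤)).op).hom ζ) ^ e₀ =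
        (M.V.presheaf.map (homOfLE h₂).op).hom ((M.V.presheaf.map (homOfLE (le_top : W₂ ≤ ⊤)).op).hom γ₀)
      rw [← hrζ₂, ← hr₀₂]; exact hRa₂
    · show b₂ * (M.V.presheaf.map (homOfLE h₂).op).hom ((M.V.presheaf.map (homOfLE (le_top : W₂ ≤ ⊤)).op).hom ζ) ^ e₁ =
        (M.V.presheaf.map (homOfLE h₂).op).hom ((M.V.presheaf.map (homOfLE (le_top : W₂ ≤ ⊤)).op).hom γ₁)
      rw [← hrζ₂, ← hr₁₂]; exact hRb₂
  have hass := associated_sections_of_mul_pow_eq_global M O W hOW a ζ hζ (![γ₀, γ₁] : Fin 2 → Γ(M.V, ⊤)) (![e₀, e₁] : Fin 2 → ℕ) hR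
  -- ### units over `D(γ₀)`, `D(γ₁)` from the relations
  have hga : ∀ i, ∀ v ∈ (O i).1, v ∈ M.V.basicOpen γ₀ → v ∈ M.V.basicOpen (a i 0) := fun i => by
    fin_cases i
    · exact fun v hv hγ => Scheme.mem_basicOpen_of_mul_eq_map h₀ hr₀₀ hRa₀ hv hγ
    · exact fun v hv hγ => Scheme.mem_basicOpen_of_mul_eq_map h₁ hr₀₁ hRa₁ hv hγ
    · exact fun v hv hγ => Scheme.mem_basicOpen_of_mul_eq_map h₂ hr₀₂ hRa₂ hv hγ
  have hgb : ∀ i, ∀ v ∈ (O i).1, v ∈ M.V.basicOpen γ₁ → v ∈ M.V.basicOpen (a i 1) := fun i => by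
    fin_cases i
    · exact fun v hv hγ => Scheme.mem_basicOpen_of_mul_eq_map h₀ hr₁₀ hRb₀ hv hγ
    · exact fun v hv hγ => Scheme.mem_basicOpen_of_mul_eq_map h₁ hr₁₁ hRb₁ hv hγ
    · exact fun v hv hγ => Scheme.mem_basicOpen_of_mul_eq_map h₂ hr₁₂ hRb₂ hv hγ
  have hZa : ∀ t i, ∀ v ∈ (O i).1, v ∈ Z₀ t → v ∈ M.V.basicOpen (a i 0) := fun t i => by
    fin_cases i
    · exact hua₀ t
    · exact hua₁ t
    · exact hua₂ t
  have hZb : ∀ t i, ∀ v ∈ (O i).1, v ∈ Z₁ t → v ∈ M.V.basicOpen (a i 1) := fun t i => by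
    fin_cases i
    · exact hub₀ t
    · exact hub₁ t
    · exact hub₂ t
  -- ### the kill
  have hO3 : ((O₀.1 : Set M.V) ∪ O₁.1) ∪ O₂.1 ⊆ ⋃ i, ((O i).1 : Set M.V) := by
    rintro x ((hx | hx) | hx)
    · exact Set.mem_iUnion.mpr ⟨0, hx⟩
    · exact Set.mem_iUnion.mpr ⟨1, hx⟩
    · exact Set.mem_iUnion.mpr ⟨2, hx⟩
  refine killsIn_one_of_sectionCharts_of_associated hp hG f M 𝔄 O 𝒦 hD hprin w hw a hsec hass (A := (ι₀ ⊕ ι₁) ⊕ Fin 2)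
    (fun s => s.elim (Sum.elim Z₀ Z₁) (![M.V.basicOpen γ₀, M.V.basicOpen γ₁] : Fin 2 → M.V.Opens)) ?_ ?_ (hF.trans hO3)
  · intro x
    rcases hcov x with hx | hx | hx | hx | hx | ⟨t, hx⟩ | ⟨t, hx⟩
    · exact Or.inl (hO3 (Or.inl (Or.inl hx)))
    · exact Or.inl (hO3 (Or.inl (Or.inr hx)))
    · exact Or.inl (hO3 (Or.inr hx))
    · exact Or.inr ⟨Sum.inr 0, hx⟩
    · exact Or.inr ⟨Sum.inr 1, hx⟩
    · exact Or.inr ⟨Sum.inl (Sum.inl t), hx⟩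
    · exact Or.inr ⟨Sum.inl (Sum.inr t), hx⟩
  · rintro ((t | t) | l) i
    · exact ⟨0, hZa t i⟩
    · exact ⟨1, hZb t i⟩
    · refine Fin.cases ?_ (fun l' => Fin.cases ?_ (fun l'' => l''.elim0) l') l
      · exact ⟨0, hga i⟩
      · exact ⟨1, hgb i⟩

end Summit.ResolutionOfSingularities.ResolutionOfSingularities.Theorems.WildQuotientResolution.S1.GameFrame.GModel

end
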